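import Summits.BirchSwinnertonDyer.BirchSwinnertonDyer.Theorems.BiquadraticEisensteinDescentHeegnerTwistCouplingInSupplyHeegnerSplitDensityCounts
import HarnessLib

set_option linter.dupNamespace false -- `Summit.BirchSwinnertonDyer.BirchSwinnertonDyer.Theorems.…` (summit = sub)
set_option autoImplicit false

/-!
# Route `BiquadraticEisensteinDescent`, crux `HeegnerTwistCouplingInSupply` (stmt-BirchSwinnertonDyer-21381) —
# crux idea `disjoint-divisibility-pigeonhole`: S3 PROVED (`HeegnerSplitDensity 10 128`) and the headline from S1 alone

Cell `pub/bsd-wall`, width-prover seat `bsd-wall-cm-bed-w4` g24 (explicit-unit, `--supports stmt-BirchSwinnertonDyer-21381`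
as helper). Third of three files on the card's density step S3 (`…DisjointDivisibilityResidues.lean`,
`…HeegnerSplitDensityCounts.lean`). PROVED here (standard axioms):

* §4 `card_mul_le_card_ambient` — from a set `G` of good classes modulo `L` (`8 ∣ L`): `#A_N(Y) ≥ #G·((3/5)(Y−4)/L − 5√Y)`
  (the squarefree members of distinct classes are disjoint subfamilies of `A_N(Y)`); specialisations
  `card_ambient_mul_sq_ge_odd` (odd prime `p`: the classes mod `8N₀p` with `c ≡ 1 (8)`, admissible, `(c/p) = 1` are good for
  `N₀p²`) and `card_ambient_mul_four_ge` (`p = 2`: admissible `c ≡ 1 (8)` mod `8N₀` are good for `4N₀`);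
* §5 ★★ **`heegnerSplitDensity_ten : HeegnerSplitDensity 10 128`** — for every `N₀ ≥ 1`, prime `p`, `Y ≥ (N₀p²)^{10}`:
  `#A_{N₀}(Y) ≤ 128·#A_{N₀p²}(Y)`. Upper count `8g((Y−4)/(8N₀)+1)` vs lower count `g·((p−1)/2)·((3/5)(Y−4)/(8N₀p) − 5√Y)` (CRT
  class count `card_mul_half_le_card_filter_split`), closed by `height_ineq`; `p ∣ N₀`: the sets are nested the other way.
  `heegnerSplitDensity_of_le : 10 ≤ A → HeegnerSplitDensity A 128`;
* §6 ★★ **`almostAllPrimes_of_levelUniform : 10 ≤ A → LevelUniformNonvanishingCount A B → AlmostAllPrimesShape A B 128`** —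
  the card's headline theorem-shape now rests on its L-side input S1 ALONE (S3 discharged), as the card claimed;
  `ambient_nonempty_at_height` (the class `c = 1` is good: `A_{N₀}((N₀(2P)²)^A) ≠ ∅` for `A ≥ 10`) removes the last side
  condition: **`almostAllPrimes_of_levelUniform'`** — for every `N₀ ≥ 1`, `P ≥ 2`, all primes `p ∈ [P, 2P]` but
  `≤ 128·(log Y/log P)·(log Y)^B` of them (`Y = (N₀(2P)²)^A`) give the crux conclusion for every CM curve of analytic rank one
  and conductor `N₀p²`, GIVEN S1.

HONEST SCOPE: S1 (`LevelUniformNonvanishingCount`, a level-uniform effective non-vanishing count for Heegner quadratic twists)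
is NOT in print and is the whole remaining content of the card's almost-all-`p` statement; the ∀-crux keeps its Cohen–Lenstra
residual for the given `p` (door `heegnerTwistCouplingInSupply_of_levelUniform_of_thin`); the crux, `C⁺` and BSD are NOT
proved; stmt-21381 is NOT closed. The constants `10`, `128` are crude and unoptimised.
-/

noncomputable section

open scoped Classical

open Finset
open Literature.NumberTheory.EllipticCurves Literature.NumberTheory.QuadraticFields

namespace Summit.BirchSwinnertonDyer.BirchSwinnertonDyer.Theorems.DisjointDivisibility

/-! ## §4 Lower count for `A_N(Y)` from a set of good classes -/

/-- **Lower count from good classes.** If `8 ∣ L`, `L ≥ 1`, `Y ≥ 4` and `G` is a set of residues `c < L` each of which is a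
good class for the level `N` modulo `L` (`c ≡ 1 (8)`; `q ∣ L ∧ (c/q) = 1` for odd primes `q ∣ N`; `(c/q) = 1` for odd primes
`q ∣ L`), then `#A_N(Y) ≥ #G · ((3/5)(Y−4)/L − 5√Y)`: the squarefree members of distinct classes are disjoint subfamilies
of `A_N(Y)`. [folklore] -/
theorem card_mul_le_card_ambient (N L Y : ℕ) (G : Finset ℕ) (h8 : 8 ∣ L) (hL : 0 < L) (hY : 4 ≤ Y)
    (hG : ∀ c ∈ G, c < L ∧ c % 8 = 1 ∧ (∀ q : ℕ, q.Prime → q ∣ N → q ≠ 2 → q ∣ L ∧ jacobiSym (c : ℤ) q = 1) ∧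
      (∀ q : ℕ, q.Prime → q ∣ L → q ≠ 2 → jacobiSym (c : ℤ) q = 1)) :
    (G.card : ℝ) * ((3 : ℝ) / 5 * (((Y : ℝ) - 4) / (L : ℝ)) - 5 * Real.sqrt Y) ≤ ((ambient N Y).card : ℝ) := by
  set S : ℕ → Finset ℤ := fun c => (Finset.Ico (-(Y : ℤ)) (-4)).filter (fun d : ℤ =>
        d ≡ (c : ℤ) [ZMOD (L : ℤ)] ∧ Squarefree d) with hS
  have hsub : G.biUnion S ⊆ ambient N Y := by
    intro d hd
    rw [Finset.mem_biUnion] at hd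
    obtain ⟨c, hc, hdc⟩ := hd
    obtain ⟨-, hc8, hJ, -⟩ := hG c hc
    exact filter_modEq_squarefree_subset_ambient N L Y c h8 hc8 hJ hdc
  have hdisj : (G : Set ℕ).PairwiseDisjoint S := by
    intro c hc c' hc' hne
    rw [Function.onFun, Finset.disjoint_left]
    intro d hd hd'
    rw [hS, Finset.mem_filter] at hd hd'
    have h1 : (c : ℤ) ≡ (c' : ℤ) [ZMOD (L : ℤ)] := hd.2.1.symm.trans hd'.2.1
    have h2 : c ≡ c' [MOD L] := by
      rw [Int.ModEq] at h1
      rw [Nat.ModEq]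
      exact_mod_cast h1
    exact hne (Nat.ModEq.eq_of_lt_of_lt h2 (hG c hc).1 (hG c' hc').1)
  have hcount : ∀ c ∈ G, (3 : ℝ) / 5 * (((Y : ℝ) - 4) / (L : ℝ)) - 5 * Real.sqrt Y ≤ ((S c).card : ℝ) := by
    intro c hc
    obtain ⟨-, hc8, -, hJL⟩ := hG c hc
    exact lower_count_class hL hY hc8 hJL
  calc (G.card : ℝ) * ((3 : ℝ) / 5 * (((Y : ℝ) - 4) / (L : ℝ)) - 5 * Real.sqrt Y)
      = ∑ _c ∈ G, ((3 : ℝ) / 5 * (((Y : ℝ) - 4) / (L : ℝ)) - 5 * Real.sqrt Y) := by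
        rw [Finset.sum_const, nsmul_eq_mul]
    _ ≤ ∑ c ∈ G, ((S c).card : ℝ) := Finset.sum_le_sum hcount
    _ = ((G.biUnion S).card : ℝ) := by rw [Finset.card_biUnion hdisj]; push_cast; rfl
    _ ≤ _ := by exact_mod_cast Finset.card_le_card hsub

/-- **Lower count, odd `p ∤ N₀`**: the classes modulo `8N₀p` with `c ≡ 1 (8)`, admissible for `N₀`, `(c/p) = 1` are good for
`N₀p²`, so `#A_{N₀p²}(Y) ≥ #G_lo · ((3/5)(Y−4)/(8N₀p) − 5√Y)`. [folklore] -/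
theorem card_ambient_mul_sq_ge_odd {N₀ p Y : ℕ} (hN₀ : 0 < N₀) (hp : p.Prime) (hp2 : p ≠ 2) (hY : 4 ≤ Y) :
    (((Finset.range (8 * N₀ * p)).filter (fun c : ℕ => c % 8 = 1 ∧
        (∀ q : ℕ, q.Prime → q ∣ N₀ → q ≠ 2 → jacobiSym (c : ℤ) q = 1) ∧ jacobiSym (c : ℤ) p = 1)).card : ℝ) *
      ((3 : ℝ) / 5 * (((Y : ℝ) - 4) / ((8 * N₀ * p : ℕ) : ℝ)) - 5 * Real.sqrt Y) ≤
    ((ambient (N₀ * p ^ 2) Y).card : ℝ) := by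
  refine card_mul_le_card_ambient (N₀ * p ^ 2) (8 * N₀ * p) Y _ (Dvd.intro (N₀ * p) (by ring))
    (Nat.mul_pos (by omega) hp.pos) hY fun c hc => ?_
  rw [Finset.mem_filter, Finset.mem_range] at hc
  obtain ⟨hcL, hc8, hJ, hJp⟩ := hc
  refine ⟨hcL, hc8, fun q hq hqN hq2 => ?_, fun q hq hqL hq2 => ?_⟩
  · rcases (Nat.Prime.dvd_mul hq).1 hqN with h | h
    · exact ⟨Dvd.dvd.mul_right (Dvd.dvd.mul_left h 8) p, hJ q hq h hq2⟩
    · have hqp : q = p := (Nat.prime_dvd_prime_iff_eq hq hp).1 (hq.dvd_of_dvd_pow h)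
      subst hqp
      exact ⟨Dvd.intro_left (8 * N₀) rfl, hJp⟩
  · rcases (Nat.Prime.dvd_mul hq).1 hqL with h | h
    · rcases (Nat.Prime.dvd_mul hq).1 h with h8 | hN
      · exact absurd ((Nat.prime_dvd_prime_iff_eq hq Nat.prime_two).1
          (hq.dvd_of_dvd_pow (show q ∣ 2 ^ 3 by simpa using h8))) hq2
      · exact hJ q hq hN hq2
    · have hqp : q = p := (Nat.prime_dvd_prime_iff_eq hq hp).1 h
      subst hqp
      exact hJp

/-- **Lower count at `p = 2`**: the admissible classes `c ≡ 1 (8)` modulo `8N₀` are good for `4N₀` (`d ≡ 1 (8)` splits `2`),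
so `#A_{4N₀}(Y) ≥ g · ((3/5)(Y−4)/(8N₀) − 5√Y)`. [folklore] -/
theorem card_ambient_mul_four_ge {N₀ Y : ℕ} (hN₀ : 0 < N₀) (hY : 4 ≤ Y) :
    (((Finset.range (8 * N₀)).filter (fun c : ℕ => c % 8 = 1 ∧
        ∀ q : ℕ, q.Prime → q ∣ N₀ → q ≠ 2 → jacobiSym (c : ℤ) q = 1)).card : ℝ) *
      ((3 : ℝ) / 5 * (((Y : ℝ) - 4) / ((8 * N₀ : ℕ) : ℝ)) - 5 * Real.sqrt Y) ≤
    ((ambient (N₀ * 2 ^ 2) Y).card : ℝ) := by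
  refine card_mul_le_card_ambient (N₀ * 2 ^ 2) (8 * N₀) Y _ (Dvd.intro N₀ rfl) (by positivity) hY
    fun c hc => ?_
  rw [Finset.mem_filter, Finset.mem_range] at hc
  obtain ⟨hcL, hc8, hJ⟩ := hc
  refine ⟨hcL, hc8, fun q hq hqN hq2 => ?_, fun q hq hqL hq2 => ?_⟩
  · rcases (Nat.Prime.dvd_mul hq).1 hqN with h | h
    · exact ⟨Dvd.dvd.mul_left h 8, hJ q hq h hq2⟩
    · exact absurd ((Nat.prime_dvd_prime_iff_eq hq Nat.prime_two).1 (hq.dvd_of_dvd_pow h)) hq2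
  · rcases (Nat.Prime.dvd_mul hq).1 hqL with h8 | hN
    · exact absurd ((Nat.prime_dvd_prime_iff_eq hq Nat.prime_two).1
        (hq.dvd_of_dvd_pow (show q ∣ 2 ^ 3 by simpa using h8))) hq2
    · exact hJ q hq hN hq2

/-! ## §5 S3 proved: `HeegnerSplitDensity 10 128` -/

/-- If `p ∣ N₀` the Heegner conditions for `N₀` and `N₀p²` coincide: `A_{N₀}(Y) ⊆ A_{N₀p²}(Y)`. [folklore] -/
theorem ambient_subset_ambient_mul_sq_of_dvd {N₀ p : ℕ} (hp : p.Prime) (hpN : p ∣ N₀) (Y : ℕ) :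
    ambient N₀ Y ⊆ ambient (N₀ * p ^ 2) Y := by
  intro d hd
  rw [mem_ambient] at hd ⊢
  obtain ⟨hI, K, hF, hNF, hK, hdisc, h4, hH⟩ := hd
  refine ⟨hI, K, hF, hNF, hK, hdisc, h4, fun q hq hqN => hH q hq ?_⟩
  rcases (Nat.Prime.dvd_mul hq).1 hqN with h | h
  · exact h
  · rw [(Nat.prime_dvd_prime_iff_eq hq hp).1 (hq.dvd_of_dvd_pow h)]; exact hpN

/-- **S3 PROVED: `HeegnerSplitDensity 10 128`.** For every `N₀ ≥ 1`, prime `p` and `Y ≥ (N₀p²)^10`: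
`#A_{N₀}(Y) ≤ 128 · #A_{N₀p²}(Y)` — at most a constant factor of the Heegner discriminants for `N₀` below `Y` is lost to the
extra splitting condition at `p`. Proof: `#A_{N₀}(Y) ≤ 8g((Y−4)/(8N₀) + 1)` by residues modulo `8N₀` (`card_ambient_le`);
`#A_{N₀p²}(Y) ≥ g·((p−1)/2)·((3/5)(Y−4)/(8N₀p) − 5√Y)` by the squarefree members of the good classes modulo `8N₀p`
(`card_ambient_mul_sq_ge_odd`, CRT count `card_mul_half_le_card_filter_split`; `p = 2`: `card_ambient_mul_four_ge`;
`p ∣ N₀`: the two sets are nested the other way); the height condition makes `(Y−4)/(8N₀) ≥ 14p√Y + 1` (`height_ineq`).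
The constants `10, 128` are crude. [folklore] -/
theorem heegnerSplitDensity_ten : HeegnerSplitDensity 10 128 := by
  intro N₀ p Y hp hN₀ hY
  have hp2 : 2 ≤ p := hp.two_le
  have hY4 : 4 ≤ Y := by
    have h1 : 4 ≤ N₀ * p ^ 2 := by nlinarith
    have h2 : N₀ * p ^ 2 ≤ (N₀ * p ^ 2) ^ 10 := Nat.le_self_pow (by norm_num) _
    omega
  by_cases hpN : p ∣ N₀
  · calc ((ambient N₀ Y).card : ℝ) ≤ ((ambient (N₀ * p ^ 2) Y).card : ℝ) := by
          exact_mod_cast Finset.card_le_card (ambient_subset_ambient_mul_sq_of_dvd hp hpN Y)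
      _ ≤ 128 * ((ambient (N₀ * p ^ 2) Y).card : ℝ) := by
          have : (0 : ℝ) ≤ ((ambient (N₀ * p ^ 2) Y).card : ℝ) := Nat.cast_nonneg _
          linarith
  -- the common upper bound and the height inequality
  set g : ℝ := (((Finset.range (8 * N₀)).filter (fun c : ℕ => c % 8 = 1 ∧
        ∀ q : ℕ, q.Prime → q ∣ N₀ → q ≠ 2 → jacobiSym (c : ℤ) q = 1)).card : ℝ) with hg
  have hg0 : 0 ≤ g := Nat.cast_nonneg _
  have hU := card_ambient_le N₀ Y hN₀ hY4
  have hH := height_ineq hN₀ hp2 hY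
  have hsqrt0 : 0 ≤ Real.sqrt Y := Real.sqrt_nonneg _
  set X : ℝ := ((Y : ℝ) - 4) / (8 * N₀) with hX
  have hN₀r : (0 : ℝ) < N₀ := by exact_mod_cast hN₀
  have hpr : (2 : ℝ) ≤ p := by exact_mod_cast hp2
  by_cases hp2' : p = 2
  · subst hp2'
    push_cast at hH
    have hL := card_ambient_mul_four_ge hN₀ hY4 (Y := Y)
    have hcast : (((8 * N₀ : ℕ) : ℝ)) = 8 * N₀ := by push_cast; ring
    rw [hcast] at hL
    -- `#A(N₀) ≤ 8g(X+1)` and `#A(4N₀) ≥ g((3/5)X − 5√Y)` with `X ≥ 28√Y + 1`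
    have h1 : 8 * g * (X + 1) ≤ 128 * (g * (3 / 5 * X - 5 * Real.sqrt Y)) := by
      nlinarith [mul_le_mul_of_nonneg_left hH hg0, mul_nonneg hg0 hsqrt0]
    calc ((ambient N₀ Y).card : ℝ) ≤ 8 * g * (X + 1) := hU
      _ ≤ 128 * (g * (3 / 5 * X - 5 * Real.sqrt Y)) := h1
      _ ≤ 128 * ((ambient (N₀ * 2 ^ 2) Y).card : ℝ) := by linarith
  · have hL := card_ambient_mul_sq_ge_odd hN₀ hp hp2' hY4 (Y := Y)
    have hG := card_mul_half_le_card_filter_split hN₀ hp hp2' hpN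
    set gl : ℝ := (((Finset.range (8 * N₀ * p)).filter (fun c : ℕ => c % 8 = 1 ∧
        (∀ q : ℕ, q.Prime → q ∣ N₀ → q ≠ 2 → jacobiSym (c : ℤ) q = 1) ∧ jacobiSym (c : ℤ) p = 1)).card : ℝ)
      with hgl
    have hodd : Odd p := hp.odd_of_ne_two hp2'
    have hhalf : (((p - 1) / 2 : ℕ) : ℝ) = ((p : ℝ) - 1) / 2 := by
      have heven : Even (p - 1) := by
        obtain ⟨k, hk⟩ := hodd; exact ⟨k, by omega⟩
      have h2 := Nat.two_mul_div_two_of_even heven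
      have : (((p - 1) / 2 : ℕ) : ℝ) * 2 = (p : ℝ) - 1 := by
        have h3 : (((2 * ((p - 1) / 2) : ℕ)) : ℝ) = ((p - 1 : ℕ) : ℝ) := by rw [h2]
        push_cast at h3
        rw [Nat.cast_sub (by omega)] at h3
        push_cast at h3
        linarith
      linarith
    have hG' : g * (((p : ℝ) - 1) / 2) ≤ gl := by
      rw [← hhalf, hg, hgl]
      exact_mod_cast hG
    have hcast : (((8 * N₀ * p : ℕ) : ℝ)) = 8 * N₀ * p := by push_cast; ring
    rw [hcast] at hL
    have hXp : ((Y : ℝ) - 4) / (8 * N₀ * p) = X / p := by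
      rw [hX, div_div]
    rw [hXp] at hL
    -- `B := (3/5) X/p − 5√Y ≥ 0` since `X ≥ 14 p √Y + 1`
    have hp0 : (0 : ℝ) < p := by linarith
    have hB : 0 ≤ 3 / 5 * (X / p) - 5 * Real.sqrt Y := by
      rw [sub_nonneg, ← mul_div_assoc, le_div_iff₀ hp0]
      nlinarith
    have hgl0 : g * (((p : ℝ) - 1) / 2) * (3 / 5 * (X / p) - 5 * Real.sqrt Y) ≤
        gl * (3 / 5 * (X / p) - 5 * Real.sqrt Y) := mul_le_mul_of_nonneg_right hG' hB
    -- `8g(X+1) ≤ 128 · g ((p−1)/2) B`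
    have hXp' : X / p * p = X := div_mul_cancel₀ X hp0.ne'
    have h1 : 8 * g * (X + 1) ≤ 128 * (g * (((p : ℝ) - 1) / 2) * (3 / 5 * (X / p) - 5 * Real.sqrt Y)) := by
      -- with `(p−1)/2 ≥ p/3`: RHS ≥ 128 g (p/3) B = g (25.6 X − (640/3) p √Y)
      have hthird : (p : ℝ) / 3 ≤ ((p : ℝ) - 1) / 2 := by
        have : (3 : ℝ) ≤ p := by exact_mod_cast (show 3 ≤ p by omega)
        linarith
      have hB' := hB
      have step : 128 * (g * ((p : ℝ) / 3) * (3 / 5 * (X / p) - 5 * Real.sqrt Y)) ≤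
          128 * (g * (((p : ℝ) - 1) / 2) * (3 / 5 * (X / p) - 5 * Real.sqrt Y)) := by
        have := mul_le_mul_of_nonneg_right (mul_le_mul_of_nonneg_left hthird hg0) hB
        linarith
      have expand : 128 * (g * ((p : ℝ) / 3) * (3 / 5 * (X / p) - 5 * Real.sqrt Y)) =
          g * (128 / 5 * X - 640 / 3 * p * Real.sqrt Y) := by
        field_simp
        ring
      rw [expand] at step
      have h2 : 8 * g * (X + 1) ≤ g * (128 / 5 * X - 640 / 3 * p * Real.sqrt Y) := by
        nlinarith [mul_le_mul_of_nonneg_left hH hg0, mul_nonneg hg0 (mul_nonneg hp0.le hsqrt0)]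
      linarith
    calc ((ambient N₀ Y).card : ℝ) ≤ 8 * g * (X + 1) := hU
      _ ≤ 128 * (g * (((p : ℝ) - 1) / 2) * (3 / 5 * (X / p) - 5 * Real.sqrt Y)) := h1
      _ ≤ 128 * (gl * (3 / 5 * (X / p) - 5 * Real.sqrt Y)) := by linarith
      _ ≤ 128 * ((ambient (N₀ * p ^ 2) Y).card : ℝ) := by linarith

/-- `HeegnerSplitDensity` is monotone in the height exponent (`(N₀p²)^A ≤ (N₀p²)^{A'}` for `A ≤ A'`), so S3 holds for every
exponent `A ≥ 10` with the constant `128`. [folklore] -/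
theorem heegnerSplitDensity_of_le {A : ℕ} (hA : 10 ≤ A) : HeegnerSplitDensity A 128 := by
  intro N₀ p Y hp hN₀ hY
  refine heegnerSplitDensity_ten N₀ p Y hp hN₀ (le_trans ?_ hY)
  exact Nat.pow_le_pow_right (Nat.mul_pos hN₀ (pow_pos hp.pos 2)) hA

/-! ## §6 The card's headline from S1 alone -/

/-- ★★ **The card's headline theorem-shape from its L-side input ALONE**: for `A ≥ 10`,
`LevelUniformNonvanishingCount A B → AlmostAllPrimesShape A B 128` (S3 = `HeegnerSplitDensity A 128` is now a theorem,
`heegnerSplitDensity_of_le`; composition `almostAllPrimes_of_inputs`). S1 is NOT in print level-uniformly; nothing is asserted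
about it. BSD is not proved; stmt-21381 is not closed. [folklore] -/
theorem almostAllPrimes_of_levelUniform {A : ℕ} (B : ℕ) (hA : 10 ≤ A) (hS1 : LevelUniformNonvanishingCount A B) :
    AlmostAllPrimesShape A B 128 :=
  almostAllPrimes_of_inputs A B (by norm_num) hS1 (heegnerSplitDensity_of_le hA)


/-- **The ambient set is non-empty at the card's height.** For `N₀ ≥ 1`, `P ≥ 1` and `A ≥ 10`, `A_{N₀}(Y) ≠ ∅` at
`Y = (N₀(2P)²)^A`: the class `c = 1 (mod 8N₀)` is good for `N₀`, so `#A_{N₀}(Y) ≥ (3/5)(Y−4)/(8N₀) − 5√Y > 0` by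
`card_mul_le_card_ambient` and `height_ineq`. (Removes the non-emptiness hypothesis of `AlmostAllPrimesShape` at this height.)
[folklore] -/
theorem ambient_nonempty_at_height {N₀ P A : ℕ} (hN₀ : 0 < N₀) (hP : 1 ≤ P) (hA : 10 ≤ A) :
    (ambient N₀ ((N₀ * (2 * P) ^ 2) ^ A)).Nonempty := by
  set Y : ℕ := (N₀ * (2 * P) ^ 2) ^ A with hYdef
  have hY10 : (N₀ * (2 * P) ^ 2) ^ 10 ≤ Y :=
    Nat.pow_le_pow_right (Nat.mul_pos hN₀ (pow_pos (by omega) 2)) hA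
  have hY4 : 4 ≤ Y := by
    have h1 : 4 ≤ N₀ * (2 * P) ^ 2 := by nlinarith
    have h2 : N₀ * (2 * P) ^ 2 ≤ (N₀ * (2 * P) ^ 2) ^ 10 := Nat.le_self_pow (by norm_num) _
    omega
  have hH := height_ineq hN₀ (show 2 ≤ 2 * P by omega) hY10
  have hG : ∀ c ∈ ({1} : Finset ℕ), c < 8 * N₀ ∧ c % 8 = 1 ∧
      (∀ q : ℕ, q.Prime → q ∣ N₀ → q ≠ 2 → q ∣ 8 * N₀ ∧ jacobiSym (c : ℤ) q = 1) ∧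
      (∀ q : ℕ, q.Prime → q ∣ 8 * N₀ → q ≠ 2 → jacobiSym (c : ℤ) q = 1) := by
    intro c hc
    rw [Finset.mem_singleton] at hc
    subst hc
    refine ⟨by omega, rfl, fun q _ hqN _ => ⟨Dvd.dvd.mul_left hqN 8, ?_⟩, fun q _ _ _ => ?_⟩ <;>
      exact_mod_cast jacobiSym.one_left q
  have hlow := card_mul_le_card_ambient N₀ (8 * N₀) Y {1} (Dvd.intro N₀ rfl) (by omega) hY4 hG
  rw [Finset.card_singleton, Nat.cast_one, one_mul] at hlow
  have hcast : ((8 * N₀ : ℕ) : ℝ) = 8 * N₀ := by push_cast; ring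
  rw [hcast] at hlow
  have hsqrt : (1 : ℝ) ≤ Real.sqrt Y := by
    rw [Real.le_sqrt (by norm_num) (Nat.cast_nonneg _)]
    have : (4 : ℝ) ≤ Y := by exact_mod_cast hY4
    linarith
  have hPr : (1 : ℝ) ≤ P := by exact_mod_cast hP
  have hpos : (0 : ℝ) < ((ambient N₀ Y).card : ℝ) := by
    push_cast at hH
    nlinarith
  rw [← Finset.card_pos]
  exact_mod_cast hpos

/-- ★★ **The card's almost-all-`p` statement from S1 ALONE, with no side condition**: for `A ≥ 10` and S1 =
`LevelUniformNonvanishingCount A B`, for every twist-core level `N₀ ≥ 1` and block `[P, 2P]` (`P ≥ 2`), all primes `p` of the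
block outside an exceptional set of size `≤ 128·(log Y/log P)·(log Y)^B` (`Y = (N₀(2P)²)^A`) satisfy: every CM curve `W/ℚ`
of analytic rank one with `N_W = N₀p²` has a coupling discriminant (Heegner for `N_W`, `|d| > 4`, `L(W^{(d)},1) ≠ 0`,
`p ∤ h(ℚ(√d))`) — the conclusion of the crux `HeegnerTwistCouplingInSupply` at `(W, p)`. S1 is NOT in print; nothing is
asserted about it; BSD is not proved; stmt-21381 is not closed. [folklore] -/
theorem almostAllPrimes_of_levelUniform' {A : ℕ} (B : ℕ) (hA : 10 ≤ A) (hS1 : LevelUniformNonvanishingCount A B)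
    (N₀ P : ℕ) (hP : 2 ≤ P) (hN₀ : 0 < N₀) :
    ∃ E : Finset ℕ,
      (E.card : ℝ) ≤ 128 * (Real.log ((N₀ * (2 * P) ^ 2) ^ A : ℕ) / Real.log P) *
          (Real.log ((N₀ * (2 * P) ^ 2) ^ A : ℕ)) ^ B ∧
      ∀ (W : WeierstrassCurve ℚ) [W.IsElliptic] [W.IsGloballyMinimal] [NeZero (W.conductorNorm ℤ)]
        (p : ℕ) [Fact p.Prime], W.HasCM → W.analyticRank = 1 → P ≤ p → p ≤ 2 * P → p ∉ E →
        W.conductorNorm ℤ = N₀ * p ^ 2 → ∃ d : ℤ, IsCouplingDisc W p d :=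
  almostAllPrimes_of_levelUniform B hA hS1 N₀ P hP hN₀ (ambient_nonempty_at_height hN₀ (by omega) hA)

end Summit.BirchSwinnertonDyer.BirchSwinnertonDyer.Theorems.DisjointDivisibility

end
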